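import Summits.ValiantsHypothesis.ValiantsHypothesis.Theorems.KPlusLogSqLawValuativeDoorProductCount
import Summits.ValiantsHypothesis.ValiantsHypothesis.Theorems.KPlusLogSqLawValuativeDoorNonSidonPrelims

/-!
# LINE `valuative_door` (crux `WeakLifting`, stmt-ValiantsHypothesis-19561) — THE SWEEP: `Dom(a d − b c) ⊆ Dom(a d) ∪ Dom(b c)`
# whenever the tied leading binomials are cancellation-free (non-archimedean `v`, any four polynomials `a, d, b, c`)

HONEST FRAMING.  Helper (cell `pub-symmetroid`, seat val-sym-lift-p1 g24, 2026-08-29; `--supports 19561 --as helper`), the engine of the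
companion `…ValuativeDoorProgressionFree` (width-two pencils: `det = a·d − b·c` by `Matrix.det_fin_two`).  Def-free, on the raw `domCount`
predicate («`E` strictly dominates every other support exponent at some radius `r > 0`»).  SWEEP PRINCIPLE: away from the finitely many
TIE RADII of `a, d, b, c` (`tieRadii_finite`: two support exponents tie at exactly one radius) each of them has a unique leading exponent
`X, Y, Z, W` (`exists_lead_of_not_mem_tieRadii`), and then (`dominant_sub_mul_split`) an exponent strictly dominating `a·d − b·c` at that
radius is `X + Y` and dominates `a·d` (landed `dominant_mul`, g21) or is `Z + W` and dominates `b·c` — PROVIDED that in the tied case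
`X + Y = Z + W`, `v(a_X d_Y) = v(b_Z c_W)` the binomial `a_X d_Y − b_Z c_W` does not cancel (`v(a_X d_Y − b_Z c_W) = max`; off the tie the
hypothesis is void).  A dominant exponent stays dominant on a neighbourhood, so its radius can be moved off any finite set
(`exists_dominant_radius_not_mem`); hence (`card_dominant_sub_mul_le`) `#Dom(a d − b c) ≤ #Dom(a d) + #Dom(b c)`, which the landed product
count `card_dominant_mul_le` turns into `≤ (#Dom a + #Dom d − 1) + (#Dom b + #Dom c − 1)`.  Nothing here is a stub of the line or closes
anything; no bearing on vW / vB, `TropicalB`, `MatrixDescartes` (18050) or VP ≠ VNP.  [elementary; ultrametric sweep]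
-/

set_option linter.dupNamespace false
set_option autoImplicit false

namespace Summit.ValiantsHypothesis.ValiantsHypothesis.Theorems.KPlusLogSqLaw.ValDoor

open Polynomial Finset Filter Topology
open scoped BigOperators Classical

variable {F : Type*} [Field F]

/-! ## §1 Ultrametric bookkeeping (the two-term laws are the landed `abv_*` of `…SidonTwoSharp` / `…NonSidonPrelims`) -/

/-- a finite sum of terms of absolute value `< B` (`B > 0`) has absolute value `< B`. [bookkeeping] -/
theorem nonarch_sum_lt (v : AbsoluteValue F ℝ) (hv : IsNonarchimedean v) {ι : Type*} (s : Finset ι) (g : ι → F)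
    {B : ℝ} (hB : 0 < B) (hg : ∀ i ∈ s, v (g i) < B) : v (∑ i ∈ s, g i) < B := by
  induction s using Finset.induction_on with
  | empty => rwa [Finset.sum_empty, map_zero]
  | insert i s hi ih =>
    rw [Finset.sum_insert hi]
    refine (hv _ _).trans_lt (max_lt (hg i (Finset.mem_insert_self i s)) (ih fun j hj => hg j ?_))
    exact Finset.mem_insert_of_mem hj

/-! ## §2 Tie radii, leads, and moving a dominant radius -/

/-- **the tie radii of a polynomial are finitely many**: the radii `r > 0` at which two distinct support exponents have equal weight
`v(h_E) r^E` form a finite set (each pair ties at exactly one radius). [elementary] -/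
theorem tieRadii_finite (v : AbsoluteValue F ℝ) (h : F[X]) :
    Set.Finite {r : ℝ | 0 < r ∧ ∃ E ∈ h.support, ∃ E' ∈ h.support, E < E' ∧
      v (h.coeff E) * r ^ E = v (h.coeff E') * r ^ E'} := by
  refine Set.Finite.subset (Set.Finite.biUnion h.support.finite_toSet fun E _ =>
    Set.Finite.biUnion h.support.finite_toSet fun E' hE' =>
      (show Set.Subsingleton {r : ℝ | 0 < r ∧ E < E' ∧ v (h.coeff E) * r ^ E = v (h.coeff E') * r ^ E'}
        from ?_).finite) ?_
  · intro r hr r' hr'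
    obtain ⟨hr0, hlt, hre⟩ := hr
    obtain ⟨hr0', -, hre'⟩ := hr'
    have hE'0 : 0 < v (h.coeff E') := v.pos (Polynomial.mem_support_iff.1 hE')
    have key : ∀ t : ℝ, 0 < t → v (h.coeff E) * t ^ E = v (h.coeff E') * t ^ E' →
        t ^ (E' - E) * v (h.coeff E') = v (h.coeff E) := by
      intro t ht hte
      have hsplit : t ^ E' = t ^ E * t ^ (E' - E) := by rw [← pow_add, Nat.add_sub_cancel' hlt.le]
      rw [hsplit] at hte
      have htE : 0 < t ^ E := pow_pos ht E
      have h2 : t ^ E * v (h.coeff E) = t ^ E * (t ^ (E' - E) * v (h.coeff E')) := by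
        rw [mul_comm (t ^ E) (v (h.coeff E)), hte]; ring
      exact (mul_left_cancel₀ htE.ne' h2).symm
    have h1 := key r hr0 hre
    have h2 := key r' hr0' hre'
    have hne : E' - E ≠ 0 := Nat.sub_ne_zero_of_lt hlt
    have h3 : r ^ (E' - E) = r' ^ (E' - E) := mul_right_cancel₀ hE'0.ne' (h1.trans h2.symm)
    exact (pow_left_inj₀ hr0.le hr0'.le hne).1 h3
  · intro r hr
    obtain ⟨hr0, E, hE, E', hE', hlt, hre⟩ := hr
    simp only [Set.mem_iUnion, Set.mem_setOf_eq]
    exact ⟨E, hE, E', hE', hr0, hlt, hre⟩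

/-- **off its tie radii a nonzero polynomial has a unique leading exponent** (strictly dominating every other index). [elementary] -/
theorem exists_lead_of_not_mem_tieRadii (v : AbsoluteValue F ℝ) (h : F[X]) (hh : h ≠ 0) {r : ℝ} (hr : 0 < r)
    (hnot : r ∉ {r : ℝ | 0 < r ∧ ∃ E ∈ h.support, ∃ E' ∈ h.support, E < E' ∧
      v (h.coeff E) * r ^ E = v (h.coeff E') * r ^ E'}) :
    ∃ A : ℕ, h.coeff A ≠ 0 ∧ ∀ E' : ℕ, E' ≠ A → v (h.coeff E') * r ^ E' < v (h.coeff A) * r ^ A := by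
  have hs : h.support.Nonempty := Polynomial.support_nonempty.2 hh
  obtain ⟨A, hA, hmax⟩ := Finset.exists_max_image h.support (fun E => v (h.coeff E) * r ^ E) hs
  refine ⟨A, Polynomial.mem_support_iff.1 hA, fun E' hne => ?_⟩
  by_cases hE' : E' ∈ h.support
  · refine lt_of_le_of_ne (hmax E' hE') fun heq => hnot ⟨hr, ?_⟩
    rcases lt_or_gt_of_ne hne with hlt | hlt
    · exact ⟨E', hE', A, hA, hlt, heq⟩
    · exact ⟨A, hA, E', hE', hlt, heq.symm⟩
  · rw [Polynomial.notMem_support_iff.1 hE', map_zero, zero_mul]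
    exact mul_pos (v.pos (Polynomial.mem_support_iff.1 hA)) (pow_pos hr A)

/-- **a dominant exponent stays dominant nearby, so its radius can be moved off any finite set.** [elementary: finitely many strict
inequalities between continuous functions persist on a neighbourhood] -/
theorem exists_dominant_radius_not_mem (v : AbsoluteValue F ℝ) (f : F[X]) {G : ℕ} {r₀ : ℝ} (hr₀ : 0 < r₀)
    (hdom : ∀ E' ∈ f.support, E' ≠ G → v (f.coeff E') * r₀ ^ E' < v (f.coeff G) * r₀ ^ G)
    {N : Set ℝ} (hN : N.Finite) :
    ∃ r : ℝ, 0 < r ∧ r ∉ N ∧ ∀ E' ∈ f.support, E' ≠ G → v (f.coeff E') * r ^ E' < v (f.coeff G) * r ^ G := by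
  have h1 : ∀ᶠ r in 𝓝 r₀, 0 < r := eventually_gt_nhds hr₀
  have h2 : ∀ᶠ r in 𝓝 r₀, ∀ E' ∈ f.support.erase G, v (f.coeff E') * r ^ E' < v (f.coeff G) * r ^ G := by
    rw [Filter.eventually_all_finset]
    intro E' hE'
    obtain ⟨hne, hmem⟩ := Finset.mem_erase.1 hE'
    have hc1 : ContinuousAt (fun r : ℝ => v (f.coeff E') * r ^ E') r₀ := by fun_prop
    have hc2 : ContinuousAt (fun r : ℝ => v (f.coeff G) * r ^ G) r₀ := by fun_prop
    exact hc1.eventually_lt hc2 (hdom E' hmem hne)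
  have h3 : ∀ᶠ r in 𝓝 r₀, r ∈ (N \ {r₀})ᶜ :=
    (hN.subset (fun x hx => hx.1 : N \ {r₀} ⊆ N)).isClosed.compl_mem_nhds (fun h => h.2 rfl)
  obtain ⟨r, hrr₀, hr, hr2, hr3⟩ := (h1.and (h2.and h3)).exists_gt
  refine ⟨r, hr, fun hrN => hr3 ⟨hrN, fun h => ?_⟩, fun E' hE' hne => hr2 E' (Finset.mem_erase.2 ⟨hne, hE'⟩)⟩
  rw [Set.mem_singleton_iff] at h
  exact (ne_of_gt hrr₀) h

/-! ## §3 One radius: the determinant's lead is the lead of one of the two products -/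

/-- the antidiagonal remainder of a product at the sum of two leads is strictly smaller than the leading product. [elementary] -/
theorem coeff_mul_sub_lead_lt (v : AbsoluteValue F ℝ) (hv : IsNonarchimedean v) (a d : F[X]) {X Y : ℕ} {r : ℝ} (hr : 0 < r)
    (haX : a.coeff X ≠ 0) (hdY : d.coeff Y ≠ 0)
    (hX : ∀ E' : ℕ, E' ≠ X → v (a.coeff E') * r ^ E' < v (a.coeff X) * r ^ X)
    (hY : ∀ E' : ℕ, E' ≠ Y → v (d.coeff E') * r ^ E' < v (d.coeff Y) * r ^ Y) :
    v ((a * d).coeff (X + Y) - a.coeff X * d.coeff Y) < v (a.coeff X * d.coeff Y) := by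
  rw [Polynomial.coeff_mul]
  have hmem : (X, Y) ∈ HasAntidiagonal.antidiagonal (X + Y) := by
    rw [HasAntidiagonal.mem_antidiagonal]
  rw [← Finset.add_sum_erase _ _ hmem, add_sub_cancel_left, map_mul]
  refine nonarch_sum_lt v hv _ _ (mul_pos (v.pos haX) (v.pos hdY)) fun p hp => ?_
  obtain ⟨hne, hp⟩ := Finset.mem_erase.1 hp
  rw [HasAntidiagonal.mem_antidiagonal] at hp
  have key : (v (a.coeff p.1) * r ^ p.1) * (v (d.coeff p.2) * r ^ p.2)
      < (v (a.coeff X) * r ^ X) * (v (d.coeff Y) * r ^ Y) := by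
    by_cases h1 : p.1 = X
    · have h2 : p.2 ≠ Y := fun h2 => hne (Prod.ext h1 h2)
      rw [h1]
      exact mul_lt_mul_of_pos_left (hY _ h2) (mul_pos (v.pos haX) (pow_pos hr X))
    · rcases eq_or_ne p.2 Y with h2 | h2
      · rw [h2]
        exact mul_lt_mul_of_pos_right (hX _ h1) (mul_pos (v.pos hdY) (pow_pos hr Y))
      · exact mul_lt_mul'' (hX _ h1) (hY _ h2) (by positivity) (by positivity)
  have h3 : v (a.coeff p.1) * v (d.coeff p.2) * r ^ (X + Y) < v (a.coeff X) * v (d.coeff Y) * r ^ (X + Y) := by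
    calc v (a.coeff p.1) * v (d.coeff p.2) * r ^ (X + Y)
        = (v (a.coeff p.1) * r ^ p.1) * (v (d.coeff p.2) * r ^ p.2) := by rw [← hp, pow_add]; ring
      _ < (v (a.coeff X) * r ^ X) * (v (d.coeff Y) * r ^ Y) := key
      _ = v (a.coeff X) * v (d.coeff Y) * r ^ (X + Y) := by rw [pow_add]; ring
  rw [map_mul]
  exact lt_of_mul_lt_mul_right h3 (pow_nonneg hr.le _)

/-- **THE SPLIT AT A SHARP RADIUS.**  At a radius `r` where `a, d, b, c` have unique leading exponents `X, Y, Z, W`, and the tied leading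
binomial (case `X + Y = Z + W`) is cancellation-free, an exponent `G` that strictly dominates `a·d − b·c` at `r` strictly dominates `a·d` at `r`
or strictly dominates `b·c` at `r` (in fact `G = X + Y`, resp. `G = Z + W`). [elementary; the heart of the sweep] -/
theorem dominant_sub_mul_split (v : AbsoluteValue F ℝ) (hv : IsNonarchimedean v) (a d b c : F[X]) {r : ℝ} (hr : 0 < r)
    {X Y Z W G : ℕ} (haX : a.coeff X ≠ 0) (hdY : d.coeff Y ≠ 0) (hbZ : b.coeff Z ≠ 0) (hcW : c.coeff W ≠ 0)
    (hX : ∀ E' : ℕ, E' ≠ X → v (a.coeff E') * r ^ E' < v (a.coeff X) * r ^ X)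
    (hY : ∀ E' : ℕ, E' ≠ Y → v (d.coeff E') * r ^ E' < v (d.coeff Y) * r ^ Y)
    (hZ : ∀ E' : ℕ, E' ≠ Z → v (b.coeff E') * r ^ E' < v (b.coeff Z) * r ^ Z)
    (hW : ∀ E' : ℕ, E' ≠ W → v (c.coeff E') * r ^ E' < v (c.coeff W) * r ^ W)
    (hAP : X + Y = Z + W → v (a.coeff X * d.coeff Y - b.coeff Z * c.coeff W)
        = max (v (a.coeff X * d.coeff Y)) (v (b.coeff Z * c.coeff W)))
    (hG : ∀ E' : ℕ, E' ≠ G → v ((a * d - b * c).coeff E') * r ^ E' < v ((a * d - b * c).coeff G) * r ^ G) :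
    (∀ E' : ℕ, E' ≠ G → v ((a * d).coeff E') * r ^ E' < v ((a * d).coeff G) * r ^ G) ∨
    (∀ E' : ℕ, E' ≠ G → v ((b * c).coeff E') * r ^ E' < v ((b * c).coeff G) * r ^ G) := by
  obtain ⟨hadv, had⟩ := dominant_mul v hv a d hr haX hdY hX hY
  obtain ⟨hbcv, hbc⟩ := dominant_mul v hv b c hr hbZ hcW hZ hW
  set f : F[X] := a * d - b * c with hf
  set wad : ℕ → ℝ := fun E => v ((a * d).coeff E) * r ^ E with hwad
  set wbc : ℕ → ℝ := fun E => v ((b * c).coeff E) * r ^ E with hwbc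
  set wf : ℕ → ℝ := fun E => v (f.coeff E) * r ^ E with hwf
  change ∀ E' : ℕ, E' ≠ X + Y → wad E' < wad (X + Y) at had
  change ∀ E' : ℕ, E' ≠ Z + W → wbc E' < wbc (Z + W) at hbc
  change ∀ E' : ℕ, E' ≠ G → wf E' < wf G at hG
  show (∀ E' : ℕ, E' ≠ G → wad E' < wad G) ∨ (∀ E' : ℕ, E' ≠ G → wbc E' < wbc G)
  have hrE : ∀ E : ℕ, 0 < r ^ E := fun E => pow_pos hr E
  have had_le : ∀ E, wad E ≤ wad (X + Y) := fun E => if h : E = X + Y then by rw [h] else (had E h).le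
  have hbc_le : ∀ E, wbc E ≤ wbc (Z + W) := fun E => if h : E = Z + W then by rw [h] else (hbc E h).le
  have hf_le : ∀ E, wf E ≤ max (wad E) (wbc E) := by
    intro E
    simp only [hwf, hwad, hwbc, hf, Polynomial.coeff_sub]
    rw [← max_mul_of_nonneg _ _ (hrE E).le]
    exact mul_le_mul_of_nonneg_right (abv_sub_le_max_na v hv _ _) (hrE E).le
  -- an exponent strictly dominating `f` at `r` is `G`
  have huniq : ∀ E, (∀ E', E' ≠ E → wf E' < wf E) → E = G := by
    intro E hE
    by_contra hne
    exact lt_asymm (hE G (Ne.symm hne)) (hG E hne)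
  -- valuation comparisons from weight comparisons at the same exponent
  have hval_lt : ∀ (p q : F[X]) (E : ℕ), v (p.coeff E) * r ^ E < v (q.coeff E) * r ^ E → v (p.coeff E) < v (q.coeff E) :=
    fun p q E h => lt_of_mul_lt_mul_right h (hrE E).le
  rcases lt_trichotomy (wbc (Z + W)) (wad (X + Y)) with hlt | heq | hgt
  · -- `a d` wins: `G = X + Y`
    left
    have hfXY : wf (X + Y) = wad (X + Y) := by
      simp only [hwf, hwad, hf, Polynomial.coeff_sub]
      rw [abv_sub_eq_first v hv (hval_lt _ _ _ ((hbc_le (X + Y)).trans_lt hlt))]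
    have hGXY : X + Y = G := huniq (X + Y) fun E' hE' =>
      calc wf E' ≤ max (wad E') (wbc E') := hf_le E'
        _ < wad (X + Y) := max_lt (had E' hE') ((hbc_le E').trans_lt hlt)
        _ = wf (X + Y) := hfXY.symm
    rw [← hGXY]
    exact had
  · by_cases hS : X + Y = Z + W
    · -- tied binomial at the common exponent: no cancellation by `hAP`
      left
      have hμ := hAP hS
      have hvv : v (a.coeff X * d.coeff Y) = v (b.coeff Z * c.coeff W) := by
        rw [map_mul, map_mul, ← hadv, ← hbcv, ← hS]
        have h1 : wbc (Z + W) = wad (X + Y) := heq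
        simp only [hwad, hwbc] at h1
        rw [← hS] at h1
        exact (mul_right_cancel₀ (hrE _).ne' h1).symm
      have hμ' : v (a.coeff X * d.coeff Y - b.coeff Z * c.coeff W) = v (a.coeff X * d.coeff Y) := by
        rw [hμ, ← hvv, max_self]
      have hrest : v (f.coeff (X + Y) - (a.coeff X * d.coeff Y - b.coeff Z * c.coeff W)) < v (a.coeff X * d.coeff Y) := by
        have e1 : f.coeff (X + Y) - (a.coeff X * d.coeff Y - b.coeff Z * c.coeff W)
            = ((a * d).coeff (X + Y) - a.coeff X * d.coeff Y) - ((b * c).coeff (Z + W) - b.coeff Z * c.coeff W) := by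
          simp only [hf, Polynomial.coeff_sub]
          rw [hS]; ring
        rw [e1]
        refine (abv_sub_le_max_na v hv _ _).trans_lt (max_lt ?_ ?_)
        · exact coeff_mul_sub_lead_lt v hv a d hr haX hdY hX hY
        · rw [hvv]
          exact coeff_mul_sub_lead_lt v hv b c hr hbZ hcW hZ hW
      have hfS : v (f.coeff (X + Y)) = v (a.coeff X * d.coeff Y) := by
        have e2 : f.coeff (X + Y) = (a.coeff X * d.coeff Y - b.coeff Z * c.coeff W)
            + (f.coeff (X + Y) - (a.coeff X * d.coeff Y - b.coeff Z * c.coeff W)) := by ring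
        rw [e2, abv_add_eq_left_of_lt v hv (by rw [hμ']; exact hrest), hμ']
      have hwfS : wf (X + Y) = wad (X + Y) := by
        simp only [hwf, hwad]
        rw [hfS, hadv, map_mul]
      have hGXY : X + Y = G := huniq (X + Y) fun E' hE' =>
        calc wf E' ≤ max (wad E') (wbc E') := hf_le E'
          _ < wad (X + Y) := max_lt (had E' hE') (by rw [← heq]; exact hbc E' (hS ▸ hE'))
          _ = wf (X + Y) := hwfS.symm
      rw [← hGXY]
      exact had
    · -- two distinct exponents of top weight: `f` is not sharp at `r`, contradiction
      exfalso
      have hfXY : wf (X + Y) = wad (X + Y) := by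
        simp only [hwf, hwad, hf, Polynomial.coeff_sub]
        rw [abv_sub_eq_first v hv (hval_lt _ _ _ ((hbc (X + Y) hS).trans_eq heq))]
      have hfZW : wf (Z + W) = wbc (Z + W) := by
        simp only [hwf, hwbc, hf, Polynomial.coeff_sub]
        rw [abv_sub_eq_second v hv (hval_lt _ _ _ ((had (Z + W) (Ne.symm hS)).trans_eq heq.symm))]
      rcases eq_or_ne G (X + Y) with hG1 | hG1
      · have h1 := hG (Z + W) (by rw [hG1]; exact Ne.symm hS)
        rw [hG1, hfZW, hfXY, heq] at h1
        exact lt_irrefl _ h1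
      · have h1 := hG (X + Y) (Ne.symm hG1)
        have h2 : wf G ≤ wad (X + Y) := (hf_le G).trans (max_le (had_le G) ((hbc_le G).trans_eq heq))
        rw [hfXY] at h1
        exact lt_irrefl _ (h1.trans_le h2)
  · -- `b c` wins: `G = Z + W`
    right
    have hfZW : wf (Z + W) = wbc (Z + W) := by
      simp only [hwf, hwbc, hf, Polynomial.coeff_sub]
      rw [abv_sub_eq_second v hv (hval_lt _ _ _ ((had_le (Z + W)).trans_lt hgt))]
    have hGZW : Z + W = G := huniq (Z + W) fun E' hE' =>
      calc wf E' ≤ max (wad E') (wbc E') := hf_le E'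
        _ < wbc (Z + W) := max_lt ((had_le E').trans_lt hgt) (hbc E' hE')
        _ = wf (Z + W) := hfZW.symm
    rw [← hGZW]
    exact hbc

/-! ## §4 The sweep: `Dom(a d − b c) ⊆ Dom(a d) ∪ Dom(b c)` and the count -/

/-- negation does not change the dominant exponents. [bookkeeping] -/
theorem dominant_filter_neg (v : AbsoluteValue F ℝ) (h : F[X]) :
    ((-h).support.filter fun E => ∃ r : ℝ, 0 < r ∧ ∀ E' ∈ (-h).support, E' ≠ E →
        v ((-h).coeff E') * r ^ E' < v ((-h).coeff E) * r ^ E)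
      = (h.support.filter fun E => ∃ r : ℝ, 0 < r ∧ ∀ E' ∈ h.support, E' ≠ E →
        v (h.coeff E') * r ^ E' < v (h.coeff E) * r ^ E) := by
  simp only [Polynomial.support_neg, Polynomial.coeff_neg, v.map_neg]

/-- **THE SWEEP.**  If at every radius where `a, d, b, c` are simultaneously sharp the tied leading binomial `a_X d_Y − b_Z c_W`
(`X + Y = Z + W`) is cancellation-free, then every dominant exponent of `a·d − b·c` is a dominant exponent of `a·d` or of `b·c`:
`#Dom(a d − b c) ≤ #Dom(a d) + #Dom(b c)`. [assembly of §2–§3] -/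
theorem card_dominant_sub_mul_le (v : AbsoluteValue F ℝ) (hv : IsNonarchimedean v) (a d b c : F[X])
    (hAP : ∀ (r : ℝ) (X Y Z W : ℕ), 0 < r → a.coeff X ≠ 0 → d.coeff Y ≠ 0 → b.coeff Z ≠ 0 → c.coeff W ≠ 0 →
      (∀ E' : ℕ, E' ≠ X → v (a.coeff E') * r ^ E' < v (a.coeff X) * r ^ X) →
      (∀ E' : ℕ, E' ≠ Y → v (d.coeff E') * r ^ E' < v (d.coeff Y) * r ^ Y) →
      (∀ E' : ℕ, E' ≠ Z → v (b.coeff E') * r ^ E' < v (b.coeff Z) * r ^ Z) →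
      (∀ E' : ℕ, E' ≠ W → v (c.coeff E') * r ^ E' < v (c.coeff W) * r ^ W) →
      X + Y = Z + W →
      v (a.coeff X * d.coeff Y - b.coeff Z * c.coeff W) = max (v (a.coeff X * d.coeff Y)) (v (b.coeff Z * c.coeff W))) :
    ((a * d - b * c).support.filter fun E => ∃ r : ℝ, 0 < r ∧ ∀ E' ∈ (a * d - b * c).support, E' ≠ E →
        v ((a * d - b * c).coeff E') * r ^ E' < v ((a * d - b * c).coeff E) * r ^ E).card
      ≤ ((a * d).support.filter fun E => ∃ r : ℝ, 0 < r ∧ ∀ E' ∈ (a * d).support, E' ≠ E →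
            v ((a * d).coeff E') * r ^ E' < v ((a * d).coeff E) * r ^ E).card
        + ((b * c).support.filter fun E => ∃ r : ℝ, 0 < r ∧ ∀ E' ∈ (b * c).support, E' ≠ E →
            v ((b * c).coeff E') * r ^ E' < v ((b * c).coeff E) * r ^ E).card := by
  set Dad := (a * d).support.filter fun E => ∃ r : ℝ, 0 < r ∧ ∀ E' ∈ (a * d).support, E' ≠ E →
      v ((a * d).coeff E') * r ^ E' < v ((a * d).coeff E) * r ^ E with hDad
  set Dbc := (b * c).support.filter fun E => ∃ r : ℝ, 0 < r ∧ ∀ E' ∈ (b * c).support, E' ≠ E →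
      v ((b * c).coeff E') * r ^ E' < v ((b * c).coeff E) * r ^ E with hDbc
  refine le_trans (Finset.card_le_card ?_) (Finset.card_union_le Dad Dbc)
  intro G hG
  -- degenerate cases: one product vanishes
  by_cases hbc0 : b = 0 ∨ c = 0
  · have h0 : b * c = 0 := by rcases hbc0 with h | h <;> simp [h]
    rw [h0, sub_zero] at hG
    exact Finset.mem_union_left _ hG
  by_cases had0 : a = 0 ∨ d = 0
  · have h0 : a * d = 0 := by rcases had0 with h | h <;> simp [h]
    rw [h0, zero_sub, dominant_filter_neg] at hG
    exact Finset.mem_union_right _ hG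
  push Not at hbc0 had0
  obtain ⟨ha0, hd0⟩ := had0
  obtain ⟨hb0, hc0⟩ := hbc0
  set f : F[X] := a * d - b * c with hf
  obtain ⟨hGsupp, r₀, hr₀, hdom⟩ := Finset.mem_filter.1 hG
  -- the tie radii of the four entry polynomials
  set T : F[X] → Set ℝ := fun h => {r : ℝ | 0 < r ∧ ∃ E ∈ h.support, ∃ E' ∈ h.support, E < E' ∧
      v (h.coeff E) * r ^ E = v (h.coeff E') * r ^ E'} with hT
  have hN : (T a ∪ T d ∪ (T b ∪ T c)).Finite :=
    ((tieRadii_finite v a).union (tieRadii_finite v d)).union ((tieRadii_finite v b).union (tieRadii_finite v c))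
  obtain ⟨r, hr, hrN, hdomr⟩ := exists_dominant_radius_not_mem v f hr₀ hdom hN
  simp only [Set.mem_union, not_or] at hrN
  obtain ⟨⟨hra, hrd⟩, hrb, hrc⟩ := hrN
  obtain ⟨X, haX, hX⟩ := exists_lead_of_not_mem_tieRadii v a ha0 hr hra
  obtain ⟨Y, hdY, hY⟩ := exists_lead_of_not_mem_tieRadii v d hd0 hr hrd
  obtain ⟨Z, hbZ, hZ⟩ := exists_lead_of_not_mem_tieRadii v b hb0 hr hrb
  obtain ⟨W, hcW, hW⟩ := exists_lead_of_not_mem_tieRadii v c hc0 hr hrc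
  -- dominance of `G` against every index
  have hfG : f.coeff G ≠ 0 := Polynomial.mem_support_iff.1 hGsupp
  have hGall : ∀ E' : ℕ, E' ≠ G → v (f.coeff E') * r ^ E' < v (f.coeff G) * r ^ G := by
    intro E' hne
    by_cases hE' : E' ∈ f.support
    · exact hdomr E' hE' hne
    · rw [Polynomial.notMem_support_iff.1 hE', map_zero, zero_mul]
      exact mul_pos (v.pos hfG) (pow_pos hr G)
  -- a strictly dominating exponent has a nonzero coefficient
  have hsupp : ∀ (h : F[X]) (E : ℕ), (∀ E' : ℕ, E' ≠ E → v (h.coeff E') * r ^ E' < v (h.coeff E) * r ^ E) →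
      E ∈ h.support := by
    intro h E hE
    rw [Polynomial.mem_support_iff]
    intro h0
    have h1 := hE (E + 1) (Nat.succ_ne_self E)
    rw [h0, map_zero, zero_mul] at h1
    exact absurd h1 (not_lt.2 (mul_nonneg (v.nonneg _) (pow_nonneg hr.le _)))
  rcases dominant_sub_mul_split v hv a d b c hr haX hdY hbZ hcW hX hY hZ hW
      (hAP r X Y Z W hr haX hdY hbZ hcW hX hY hZ hW) hGall with h | h
  · exact Finset.mem_union_left _ (Finset.mem_filter.2 ⟨hsupp _ G h, r, hr, fun E' _ hne => h E' hne⟩)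
  · exact Finset.mem_union_right _ (Finset.mem_filter.2 ⟨hsupp _ G h, r, hr, fun E' _ hne => h E' hne⟩)

end Summit.ValiantsHypothesis.ValiantsHypothesis.Theorems.KPlusLogSqLaw.ValDoor
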